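import Summits.AtomisticToContinuum.BoseEinsteinCondensation.Theorems.BECInfDivCoherenceGridInfDivCoherenceSignNecessity
import HarnessLib

/-!
# Crux `GridInfDivCoherence` (stmt-AtomisticToContinuum-9114), line `registered`: the closure step
# `stub_reTranslate_nonneg_of_slack` of the positivity-necessity theorem (lead c6)

Fixed box `L > 0`, repulsive finite-range `v`, slack `δ`. HYPOTHESIS: every periodic `C¹` Bose trial state `Ψ` with
`periodicEnergy v Ψ ≤ E₀ + δ` has positive cell coherence `re ∫_{cell^N} conj Ψ(…, xᵢ + r, …) Ψ(X) dX > 0` at the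
given particle `i` and shift `r`. CLAIM: every UNIT Bose-symmetric `ξ ∈ L²((ℝ/ℤ)^{3N})` of finite maximal form with
a margin `maxForm ξ + e ≤ E₀ + δ` (`e > 0` real) has `re⟪τ_{i, r/L} ξ, ξ⟫ ≥ 0`, where `τ` is the single-particle
torus translation (Mathlib's `Lp.compMeasurePreservingₗᵢ`).

Proof. MaxFormApproximation for every repulsive finite-range profile, hard cores included
(`NearMinTower.stub_maxFormApproximationFiniteRange`, B. Simon's "maximal form = minimal form" in the Bose sector),
applied to `ξ` at accuracy `εₖ = min e (1/(k+1))`, gives periodic trial states `Φₖ` with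
`periodicEnergy v Φₖ ≤ maxForm ξ + εₖ ≤ maxForm ξ + e ≤ E₀ + δ` and `‖ι₀Φₖ − ξ‖ ≤ εₖ ≤ 1/(k+1)`, so `ι₀Φₖ → ξ`
in `L²`; by the hypothesis the cell coherences of the `Φₖ` at `(i, r)` are `> 0`, and they converge to the
amplitude `re⟪τ_{i, r/L} ξ, ξ⟫` (`GridLevySignReduction.tendsto_re_cellCoherence`), which is therefore `≥ 0`.

This is the "closure step" of lead c6's necessity theorem `reTranslate_groundState_pos_of_slack`
(crux `GridInfDivCoherence` at a box ⇒ every unit maximal-form ground state has positive translation coherence).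

References: Reed–Simon IV Thm XIII.64 [ReedSimonIV1978]; B. Simon, J. Operator Theory 1 (1979) 37–47.
-/

noncomputable section

namespace Summit.AtomisticToContinuum.BoseEinsteinCondensation.Theorems

open MeasureTheory Filter Literature.MathematicalPhysics.QuantumManyBody Literature.MathematicalPhysics.QuantumManyBody.BoseGas
  Literature.Analysis.FunctionSpaces
open scoped ENNReal NNReal ComplexConjugate InnerProductSpace Topology

attribute [local instance] formDomain_measureSpace formDomain_isProbabilityMeasure
  formDomain_isProbabilityMeasure_pi comparison_isAddHaarMeasure comparison_isAddRightInvariant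

namespace ReTranslateNonneg

open Summit.AtomisticToContinuum.BoseEinsteinCondensation.Cruxes.StaticResponseBound.UvThomsonForceWave
open Summit.AtomisticToContinuum.BoseEinsteinCondensation.Cruxes.HardCoreExtension.NearMinTower
  (stub_maxFormApproximationFiniteRange)

variable {N : ℕ} {L : ℝ} {v : ℝ → ℝ≥0∞}

/-- **Unit Bose-symmetric classes with a margin are `L²` limits of trial states inside the slack** (every repulsive
finite-range `v`, hard cores included): for a unit Bose-symmetric `ξ` of finite maximal form and `e > 0` there are
periodic trial states `Φ_k` with `periodicEnergy v Φ_k ≤ maxForm ξ + e` whose free-embedded classes converge to `ξ`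
in `L²((ℝ/ℤ)^{3N})` (MaxFormApproximation `stub_maxFormApproximationFiniteRange` at accuracy `min e (1/(k+1))`).
[cite: ReedSimonIV1978, Thm XIII.64] -/
theorem exists_trialStates_tendsto_of_margin (hv : IsRepulsiveFiniteRange v) (hL : 0 < L)
    {ξ : Lp ℂ 2 (volume : Measure (UnitAddTorus (Fin N × Fin 3)))}
    (hsymm : ξ ∈ boseSymmetric N) (hξ1 : ‖ξ‖ = 1) (hfin : maxForm v L ξ ≠ ⊤) {e : ℝ} (he : 0 < e) :
    ∃ Φ : ℕ → PeriodicTrialState N L,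
      (∀ k, periodicEnergy v (Φ k) ≤ maxForm v L ξ + ENNReal.ofReal e) ∧
      Tendsto (fun k => (formEmbed hL measurable_zeroProfile (lintegral_periodicInteraction_zero_ne_top N L)
        ⟨graphEmbed hL measurable_zeroProfile (lintegral_periodicInteraction_zero_ne_top N L)
          ⟨(Φ k).ψ, (Φ k).mem_periodicCore⟩,
          graphEmbed_mem_formDomain hL measurable_zeroProfile (lintegral_periodicInteraction_zero_ne_top N L) _⟩ :
        Lp ℂ 2 (volume : Measure (UnitAddTorus (Fin N × Fin 3))))) atTop (𝓝 ξ) := by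
  have happrox := fun k : ℕ =>
    stub_maxFormApproximationFiniteRange v hv N L hL ξ hξ1 hsymm hfin (min e (1 / ((k : ℝ) + 1)))
      (lt_min he Nat.one_div_pos_of_nat)
  choose Φ hΦE hΦd using happrox
  refine ⟨Φ, fun k => (hΦE k).trans (add_le_add le_rfl (ENNReal.ofReal_le_ofReal (min_le_left _ _))), ?_⟩
  rw [tendsto_iff_norm_sub_tendsto_zero]
  exact squeeze_zero (fun k => norm_nonneg _) (fun k => (hΦd k).trans (min_le_right _ _))
    tendsto_one_div_add_atTop_nhds_zero_nat

end ReTranslateNonneg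

/-- **`stub_reTranslate_nonneg_of_slack`** (registered by lead c6; closure step of the positivity-necessity theorem).
Fixed box `L > 0`, repulsive finite-range `v`, slack `δ`: if every periodic trial state `Ψ` with
`periodicEnergy v Ψ ≤ E₀ + δ` has positive cell coherence at particle `i` and shift `r`, then every UNIT
Bose-symmetric `ξ ∈ L²((ℝ/ℤ)^{3N})` of finite maximal form with a margin `maxForm ξ + e ≤ E₀ + δ` (`e > 0`) has
`re⟪τ_{i, r/L} ξ, ξ⟫ ≥ 0`. Proof: MaxFormApproximation (`NearMinTower.stub_maxFormApproximationFiniteRange`,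
accuracy `min e (1/(k+1))`) gives trial states `Φ_k → ξ` in `L²` inside the slack; their cell coherences are `> 0`
and converge to the amplitude of `ξ` (`GridLevySignReduction.tendsto_re_cellCoherence`).
[cite: ReedSimonIV1978, Thm XIII.64] -/
theorem stub_reTranslate_nonneg_of_slack :
    ∀ (N : ℕ) (L : ℝ) (v : ℝ → ℝ≥0∞), IsRepulsiveFiniteRange v → 0 < L →
      ∀ (δ : ℝ≥0∞) (i : Fin N) (r : EuclideanSpace ℝ (Fin 3)),
        (∀ Ψ : PeriodicTrialState N L,
          periodicEnergy v Ψ ≤ periodicGroundStateEnergy v N L + δ →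
            0 < (∫ X in cellN N L, conj (Ψ.ψ (Function.update X i (X i + r))) * Ψ.ψ X).re) →
        ∀ ξ : Lp ℂ 2 (volume : Measure (UnitAddTorus (Fin N × Fin 3))),
          ξ ∈ boseSymmetric N → ‖ξ‖ = 1 → maxForm v L ξ ≠ ⊤ → ∀ e : ℝ, 0 < e →
            maxForm v L ξ + ENNReal.ofReal e ≤ periodicGroundStateEnergy v N L + δ →
            0 ≤ (⟪(Lp.compMeasurePreservingₗᵢ ℂ
                (fun t : UnitAddTorus (Fin N × Fin 3) => t + fun p : Fin N × Fin 3 =>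
                  (Pi.single i (toUnitTorus L r) : Fin N → UnitAddTorus (Fin 3)) p.1 p.2)
                (measurePreserving_add_right volume _) ξ), ξ⟫_ℂ).re := by
  intro N L v hv hL δ i r hP ξ hsymm hξ1 hfin e he hmargin
  obtain ⟨Φ, hΦE, hconv⟩ := ReTranslateNonneg.exists_trialStates_tendsto_of_margin hv hL hsymm hξ1 hfin he
  -- the cell coherences of the approximants converge to the amplitude of `ξ` and are positive
  exact ge_of_tendsto' (GridLevySignReduction.tendsto_re_cellCoherence hL Φ ξ hconv i r) fun k =>
    (hP (Φ k) ((hΦE k).trans hmargin)).le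

end Summit.AtomisticToContinuum.BoseEinsteinCondensation.Theorems

end
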